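import Summits.QuantumFields.YangMills.Theorems.AlphaInputsT3ACv3SymAvgCoverGeometry
import Summits.QuantumFields.YangMills.Theorems.AlphaInputsT3ACv3EMLIterFirstOrderUniform
import Summits.QuantumFields.YangMills.Theorems.AlphaInputsT3ACv3RegionAxialGauge
import HarnessLib

/-!
# `AlphaInputsT3ACv3SymAvgGaugeClamp` — R3 2′χ (O″χ) B1, the (α)-seam re-reading R-ii, analytic core (69)_sym, PIECE (ii): **THE GAUGE-CLAMP PLUMBING** — under the
# read-local (68)-type bound `‖U(∂q) − 1‖ ≤ a` on the fine plaquettes of the cover `Δ′(p′)` of a coarse plaquette `p′ ∈ T^{(j)}`, the `j`-fold (0.4)-average of record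
# at `∂p′` is, up to ONE conjugation, the `j`-fold average of a GLOBALLY `δ`-small clamped gauge copy `Ũ` (`δ = (d+2)·L^j·a`), to which [Balaban1985Averaging] Prop. 4 with
# the `k`-UNIFORM constant (`EMLIterUniform.norm_iter_sub_one_sub_iterLin_le_uniform`) applies — lane `pub-balaban3d` ∕ cell `ym3-torus`, seat `ym-ust-19936-w2` (g4)

WHY (★w6-19936 g2 `LOCATE-alpha-seam-w6-g2.md` §2 (ii); ★★OWNER RULING g26-№13 (ii)∕№14: R-ii FINAL; LEAD ★w1-19936 g3 B1 PLAN v3).  The seam row of record becomes (71)_sym per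
recorded plaquette (✓`SmallFactor71Sym.smallFactor_of_large69_unitary`), whose only new analytic input is (69)_sym: the symmetric `j`-fold average `(blockAvg ℰp)^j U(∂p′)` is within a
`j`-UNIFORM second order of print's rigid first-order flux sum over the fine plaquettes of `Δ′(p′)`.  The `j`-uniform second order is in the tree (`…EMLIterFirstOrderUniform`; piece
(iii) `…SymAvgPlaqAssembly` of ★w7 g3 reads it at a plaquette) but for a field that is GLOBALLY within `δ` of `1`, while the class `reg68LocalSet` only bounds the plaquettes UNDER
`p′`.  This file is the plumbing between the two ([Balaban1985Averaging] p. 26: «it is enough to assume (52) for `p ⊂ B^k(x) ∪ B^k(y) ∪ B^k(z) ∪ B^k(w)`»): (1) the regional axial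
gauge `v₀ = U(Γ_{y,·})` from the lower corner `y` of `Δ′(p′)` (`RegionAxialGauge.dist1_gaugeActT_axialT_le_of_box`, run inside the product box of the sibling
`…SymAvgCoverGeometry.mem_plaqCover_iff_exists_offset`) makes every bond with both ends in `Δ′(p′)` within `|x − y|₁·a ≤ (d+2)L^j·a` of `1`; (2) the CLAMP `Ũ := U^{v₀}` on those bonds,
`1` elsewhere, is globally `δ`-small; (3) the bonds over `Δ′(p′)` are dependency-closed (`…SymAvgCoverGeometry.plaqHol_iter_eq_of_eqOn_cover`), so `Ū̃^{(j)} = (U^{v₀})‾^{(j)} =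
(Ū^{(j)})^{v₀↾T^{(j)}}` at `∂p′` ([Balaban1985Averaging] (11) iterated, `T4Continuum.iter_gaugeAct`) and `Ū^{(j)}(∂p′)` is a conjugate of `Ū̃^{(j)}(∂p′)`; (4) Prop. 4 for `Ũ`.
WHAT IS HERE (def-free; generic `P : Params`; any `GaugeGroup`∕`LoopAverage` in §§3–4, `SU(N)`∕`expMeanLogSU` in §5).  §3 ★ `dist1_gaugeAct_axialT_le_of_cover` (the regional axial
gauge under `p′`, constant `c_g = d + 2`, base at the LOWER CORNER); §4 ★★ `exists_clamp` (the clamp: `= U^{v₀}` on the cover, `= 1` off it, global `(d+2)L^j·a`-smallness, fine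
plaquettes over the cover conjugate to those of `U`, `Ū̃^{(j)} = (Ū^{(j)})^{v₀↾T^{(j)}}` at the bonds over the cover, `Ū̃^{(j)}(∂p′) = w·Ū^{(j)}(∂p′)·w⁻¹`); §5 ★★★ `exists_clamp_expansion`
(§4 + Prop. 4 `j`-uniform, in norms: `‖Ũ_b − 1‖ ≤ δ`, `‖Ũ(∂q) − 1‖ = ‖U(∂q) − 1‖` over the cover, `‖Ū^{(j)}(∂p′) − 1‖ = ‖Ū̃^{(j)}(∂p′) − 1‖`, and for all `s ≤ j`, all level-`s` bonds
`c`: `‖Ū̃^{(s)}(c) − 1‖ ≤ 2m_s`, `‖Ū̃^{(s)}(c) − 1 − (Q^{(s)}Ỹ)(c)‖ ≤ 324L(d+2)²m_s²`, `m_s = 2|n|²(d+1)L^s·δ`; with `a = α₀L^{−2j}`, `m_j = 2|n|²(d+1)(d+2)·α₀` is `j`-FREE) — the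
(ii)-output consumed by pieces (i) (★w6 g2 ✓`…LinAvgIterFluxRigid`), (iii)+(iv) (★w7 g3 `…SymAvgPlaqAssembly`: its `hU`∕`δ` binders are this file's `Ũ`).
HONEST FRAMING.  Kinematics∕bookkeeping over the tree's tori plus one call of the tree's Prop. 4; nothing of [Balaban1985UV3] (67)–(71) is asserted; (69)_sym itself is NOT proved
here (it is the assembly of (i)–(iv)); count-neutral helper toward R3 2′χ (`stub_laneRecordsV3Chi`∕v5p10, item 19936), registry untouched; nothing about d = 4, the continuum, or a
mass gap; YM₃ on T³ is rung R3 of the programme, NOT the Clay problem.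

References: T. Bałaban, Commun. Math. Phys. 98 (1985) 17–51 [Balaban1985Averaging] ((8)–(11) p.19, pp.24–26 incl. Prop. 2 (52)–(54), Prop. 4 (134)–(135) p.38); CMP 102 (1985)
255–275 [Balaban1985UV3] ((67)–(70) p.273); CMP 109 (1987) 249–301 [Balaban1987RG1] ((0.4), (0.11) p.253).
-/

set_option autoImplicit false

noncomputable section

namespace Summit.QuantumFields.YangMills.Theorems.SymAvgGaugeClamp

open Literature.MathematicalPhysics.QuantumFieldTheory.Balaban1983to89
open T4Continuum BlockAveraging ExpMeanLog BlockAveragingEMLLinearised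
open Literature.MathematicalPhysics.QuantumFieldTheory.Balaban1983to89.B10Eq38TorusDomains (toFine toFine_zero cornerSet plaqsIn mem_plaqsIn_iff)
open Literature.MathematicalPhysics.QuantumFieldTheory.Balaban1983to89.B10Eq27TorusAxialLog (gaugeActT axialT rel rel_apply gaugeActT_apply)
open B7Prop1Explicit (l1 e e_apply)
open B10Eq70Squaring (side)
open Summit.QuantumFields.Balaban3D.Carriers (coarsen plaqCover)
open Summit.QuantumFields.YangMills.Theorems (cornerSet_subset_plaqCover)
open Summit.QuantumFields.YangMills.Theorems.SymAvgCover (sum_side_eq mem_plaqCover_iff_exists_offset side_le two_mul_pow_le_half_sitesPerDir_zero offset_unique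
  iter_eq_of_eqOn_cover plaqHol_iter_eq_of_eqOn_cover)
open Summit.QuantumFields.YangMills.Theorems.RegionAxialGauge (dist1_gaugeActT_axialT_le_of_box)
open Summit.QuantumFields.YangMills.Theorems.EMLIterUniform (norm_iter_sub_one_sub_iterLin_le_uniform)
open scoped Matrix.Norms.L2Operator

variable {P : Params} {j : ℕ}

/-! ## §3 The regional axial gauge under `p′` -/

/-- **★ THE REGIONAL AXIAL GAUGE UNDER `p′`** (`j < m + K`, any `GaugeGroup`): if the fine plaquettes with all corners in `Δ′(p′)` are within `a ≥ 0` of `1`, the axial gauge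
`v₀ = U(Γ_{y,·})` from the LOWER CORNER `y` of `Δ′(p′)` (`y_κ = (p′.src)_κ·L^j`) makes every bond with both ends in `Δ′(p′)` within `|x − y|₁·a ≤ (d+2)·L^j·a` of `1`
(`|x − y|₁ < Σ_κ side_κ = (d+2)L^j`; the comb fan of the bond stays in the product box `Δ′(p′)`). [cite: Balaban1985Averaging, (8) p.19 and pp.24-26] -/
theorem dist1_gaugeAct_axialT_le_of_cover {G : Type*} [GaugeGroup G] (hj : j + 1 ≤ P.m + P.K) (p : Plaq P j) (U : GaugeField P 0 G)
    {a : ℝ} (ha : 0 ≤ a) (hU : ∀ q ∈ plaqsIn 0 (plaqCover p), dist1 (GaugeField.plaqHol U q) ≤ a)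
    (b : PBond P 0) (hsrc : b.src ∈ plaqCover p) (htgt : b.tgt ∈ plaqCover p) :
    dist1 (GaugeField.gaugeAct (axialT U (fun κ => ((((p.src κ).val * P.L ^ j : ℕ)) : ZMod (P.sitesPerDir 0)))) U b) ≤
      ((P.d : ℝ) + 2) * (P.L : ℝ) ^ j * a := by
  classical
  have hj0 : j ≤ P.m + P.K := (Nat.le_succ j).trans hj
  have hμν : p.μ ≠ p.ν := ne_of_lt p.hμν
  have hhalf := two_mul_pow_le_half_sitesPerDir_zero hj
  set y : Site P 0 := fun κ => ((((p.src κ).val * P.L ^ j : ℕ)) : ZMod (P.sitesPerDir 0)) with hy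
  -- the product-set description of the cover
  set I : Fin P.d → Set (ZMod (P.sitesPerDir 0)) := fun κ => {t | ∃ n : ℕ, n < side (P.L ^ j) p.μ p.ν κ ∧ t = y κ + (n : ZMod (P.sitesPerDir 0))}
    with hI
  have hIcover : ∀ z : Site P 0, (∀ κ, z κ ∈ I κ) → z ∈ plaqCover p := by
    intro z hz
    have hz' : ∀ κ, ∃ n : ℕ, n < side (P.L ^ j) p.μ p.ν κ ∧ z κ = y κ + (n : ZMod (P.sitesPerDir 0)) := fun κ => hz κ
    choose n hn hz'' using hz'
    exact (mem_plaqCover_iff_exists_offset hj0 p z).mpr ⟨n, hn, fun κ => by rw [hz'' κ, hy]; push_cast; ring⟩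
  have hcoverI : ∀ z : Site P 0, z ∈ plaqCover p →
      ∃ n : Fin P.d → ℕ, (∀ κ, n κ < side (P.L ^ j) p.μ p.ν κ) ∧ ∀ κ, z κ = y κ + (n κ : ZMod (P.sitesPerDir 0)) := by
    intro z hz
    obtain ⟨n, hn, hz⟩ := (mem_plaqCover_iff_exists_offset hj0 p z).mp hz
    exact ⟨n, hn, fun κ => by rw [hz κ, hy]; push_cast; ring⟩
  -- the plaquette hypothesis on the product set
  have hW : ∀ q : Plaq P 0, q.src ∈ {z : Site P 0 | ∀ κ, z κ ∈ I κ} →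
      (q.src.shift q.μ).shift q.ν ∈ {z : Site P 0 | ∀ κ, z κ ∈ I κ} → dist1 (GaugeField.plaqHol U q) ≤ a := by
    intro q h1 h4
    have h1' : ∀ κ, q.src κ ∈ I κ := h1
    have h4' : ∀ κ, ((q.src.shift q.μ).shift q.ν) κ ∈ I κ := h4
    have hqμν : q.μ ≠ q.ν := ne_of_lt q.hμν
    have hfarμ : ((q.src.shift q.μ).shift q.ν) q.μ = q.src q.μ + 1 := by simp [Site.shift_apply, hqμν]
    have hfarν : ((q.src.shift q.μ).shift q.ν) q.ν = q.src q.ν + 1 := by simp [Site.shift_apply, hqμν.symm]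
    have h2 : ∀ κ, (q.src.shift q.μ) κ ∈ I κ := by
      intro κ
      rw [Site.shift_apply]
      split_ifs with h
      · subst h; rw [← hfarμ]; exact h4' q.μ
      · exact h1' κ
    have h3 : ∀ κ, (q.src.shift q.ν) κ ∈ I κ := by
      intro κ
      rw [Site.shift_apply]
      split_ifs with h
      · subst h; rw [← hfarν]; exact h4' q.ν
      · exact h1' κ
    apply hU q
    rw [mem_plaqsIn_iff]
    intro z hz
    simp only [cornerSet, toFine_zero, Set.mem_insert_iff, Set.mem_singleton_iff] at hz
    rcases hz with rfl | rfl | rfl | rfl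
    · exact hIcover _ h1'
    · exact hIcover _ h2
    · exact hIcover _ h3
    · exact hIcover _ h4'
  -- offsets of the two endpoints of `b`
  obtain ⟨n, hn, hbn⟩ := hcoverI b.src hsrc
  obtain ⟨n', hn', hbn'⟩ := hcoverI b.tgt htgt
  have hndir : n b.dir + 1 < side (P.L ^ j) p.μ p.ν b.dir := by
    have h := hbn' b.dir
    have ht : b.tgt b.dir = b.src b.dir + 1 := by
      show (b.src.shift b.dir) b.dir = _
      rw [Site.shift_apply, if_pos rfl]
    rw [ht, hbn b.dir, add_assoc, ← Nat.cast_add_one] at h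
    have hs1 := side_le (P.L ^ j) p.μ p.ν b.dir
    have hlt := hn b.dir
    have heq := offset_unique hj (a := n b.dir + 1) (a' := n' b.dir) (by omega) (by have := hn' b.dir; omega) (add_left_cancel h)
    have := hn' b.dir
    omega
  have hrel : ∀ κ, rel y b.src κ = (n κ : ℤ) := by
    intro κ
    rw [rel_apply, hbn κ, add_sub_cancel_left]
    exact ZMod.valMinAbs_natCast_of_le_half (by have := hn κ; have := side_le (P.L ^ j) p.μ p.ν κ; omega)
  have hwrap : (rel y b.src b.dir + 1) * 2 ≤ (P.sitesPerDir 0 : ℤ) := by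
    rw [hrel]
    have h1 : (n b.dir + 1) * 2 ≤ P.sitesPerDir 0 := by
      have := side_le (P.L ^ j) p.μ p.ν b.dir
      have := Nat.div_mul_le_self (P.sitesPerDir 0) 2
      omega
    exact_mod_cast h1
  have hbox : ∀ (κ : Fin P.d) (t : ℤ), min 0 (min (rel y b.src κ) ((rel y b.src + e b.dir) κ)) ≤ t →
      t ≤ max 0 (max (rel y b.src κ) ((rel y b.src + e b.dir) κ)) → y κ + ((t : ℤ) : ZMod (P.sitesPerDir 0)) ∈ I κ := by
    intro κ t ht0 ht1
    rw [Pi.add_apply, hrel κ, e_apply] at ht0 ht1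
    have hn0 : (0 : ℤ) ≤ (n κ : ℤ) := Int.natCast_nonneg _
    have hε0 : (0 : ℤ) ≤ if κ = b.dir then 1 else 0 := by split_ifs <;> norm_num
    have hle1 : (n κ : ℤ) ≤ (n κ : ℤ) + if κ = b.dir then 1 else 0 := by linarith
    have ht0' : 0 ≤ t := by
      have hmin : min (0 : ℤ) (min (n κ : ℤ) ((n κ : ℤ) + if κ = b.dir then 1 else 0)) = 0 := min_eq_left (le_min hn0 (hn0.trans hle1))
      rw [hmin] at ht0
      exact ht0
    have hmax : max (0 : ℤ) (max (n κ : ℤ) ((n κ : ℤ) + if κ = b.dir then 1 else 0)) = (n κ : ℤ) + if κ = b.dir then 1 else 0 := by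
      rw [max_eq_right hle1, max_eq_right (hn0.trans hle1)]
    rw [hmax] at ht1
    have hbound : t < side (P.L ^ j) p.μ p.ν κ := by
      by_cases hκ : κ = b.dir
      · subst hκ
        rw [if_pos rfl] at ht1
        have := hndir
        have : ((n b.dir : ℤ) + 1) < side (P.L ^ j) p.μ p.ν b.dir := by exact_mod_cast this
        linarith
      · rw [if_neg hκ, add_zero] at ht1
        have : (n κ : ℤ) < side (P.L ^ j) p.μ p.ν κ := by exact_mod_cast hn κ
        linarith
    have ht : ((t : ℤ) : ZMod (P.sitesPerDir 0)) = ((t.toNat : ℕ) : ZMod (P.sitesPerDir 0)) := by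
      rw [← Int.cast_natCast, Int.toNat_of_nonneg ht0']
    refine ⟨t.toNat, ?_, by rw [ht]⟩
    have : (t.toNat : ℤ) < side (P.L ^ j) p.μ p.ν κ := by rw [Int.toNat_of_nonneg ht0']; exact hbound
    exact_mod_cast this
  have hmain := dist1_gaugeActT_axialT_le_of_box (I := I) U ha hW y b.src b.dir hwrap hbox
  have hl1 : (l1 (rel y b.src) : ℝ) ≤ ((P.d : ℝ) + 2) * (P.L : ℝ) ^ j := by
    have h1 : l1 (rel y b.src) = ∑ κ, n κ := by
      unfold l1
      exact Finset.sum_congr rfl fun κ _ => by rw [hrel κ]; simp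
    have h2 : ∑ κ, n κ ≤ ∑ κ, side (P.L ^ j) p.μ p.ν κ := Finset.sum_le_sum fun κ _ => (hn κ).le
    rw [sum_side_eq _ hμν, ← h1] at h2
    calc (l1 (rel y b.src) : ℝ) ≤ (((P.d + 2) * P.L ^ j : ℕ) : ℝ) := by exact_mod_cast h2
      _ = ((P.d : ℝ) + 2) * (P.L : ℝ) ^ j := by push_cast; ring
  calc dist1 (GaugeField.gaugeAct (axialT U y) U b) = dist1 (gaugeActT (axialT U y) U ⟨b.src, b.dir⟩) := rfl
    _ ≤ (l1 (rel y b.src) : ℝ) * a := hmain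
    _ ≤ ((P.d : ℝ) + 2) * (P.L : ℝ) ^ j * a := mul_le_mul_of_nonneg_right hl1 ha

/-! ## §4 The clamp -/

/-- **★★ THE GAUGE CLAMP** (`j < m + K`, any `GaugeGroup`, any `LoopAverage ℰ`): under the plaquette bound `a` on `Δ′(p′)` there are a gauge transformation `v` (the axial gauge of
§3) and a configuration `Ũ` — EQUAL TO `U^v` on the bonds with both ends in `Δ′(p′)` and TO `1` elsewhere — such that: every bond variable of `Ũ` is within `(d+2)L^j·a` of `1`;
the fine plaquettes of `Ũ` over `Δ′(p′)` are the conjugates `v(q₋)·U(∂q)·v(q₋)⁻¹`; at every level-`j` bond over the cover (in particular the four bonds of `∂p′`) the `j`-fold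
(0.4)-averages satisfy `Ū̃^{(j)} = (Ū^{(j)})^{v↾T^{(j)}}` (locality §2 + [Balaban1985Averaging] (11) iterated, `T4Continuum.iter_gaugeAct`); hence
`Ū̃^{(j)}(∂p′) = w·Ū^{(j)}(∂p′)·w⁻¹`, `w = (v↾T^{(j)})(p′.src)`. [cite: Balaban1985Averaging, (8)-(11) p.19 and p.26] -/
theorem exists_clamp {G : Type*} [GaugeGroup G] (ℰ : LoopAverage G) (hj : j + 1 ≤ P.m + P.K) (p : Plaq P j) (U : GaugeField P 0 G)
    {a : ℝ} (ha : 0 ≤ a) (hU : ∀ q ∈ plaqsIn 0 (plaqCover p), dist1 (GaugeField.plaqHol U q) ≤ a) :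
    ∃ (v : GaugeTransf P 0 G) (Ut : GaugeField P 0 G),
      (∀ b : PBond P 0, b.src ∈ plaqCover p → b.tgt ∈ plaqCover p → Ut b = GaugeField.gaugeAct v U b) ∧
      (∀ b : PBond P 0, ¬ (b.src ∈ plaqCover p ∧ b.tgt ∈ plaqCover p) → Ut b = 1) ∧
      (∀ b : PBond P 0, dist1 (Ut b) ≤ ((P.d : ℝ) + 2) * (P.L : ℝ) ^ j * a) ∧
      (∀ q ∈ plaqsIn 0 (plaqCover p), GaugeField.plaqHol Ut q = v q.src * GaugeField.plaqHol U q * (v q.src)⁻¹) ∧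
      (∀ c : PBond P j, toFine j c.src ∈ plaqCover p → toFine j c.tgt ∈ plaqCover p →
        Averaging.iter (fun i => (blockAvg ℰ : Averaging P i G)) j Ut c =
          GaugeField.gaugeAct (transfUp v j) (Averaging.iter (fun i => (blockAvg ℰ : Averaging P i G)) j U) c) ∧
      GaugeField.plaqHol (Averaging.iter (fun i => (blockAvg ℰ : Averaging P i G)) j Ut) p =
        transfUp v j p.src * GaugeField.plaqHol (Averaging.iter (fun i => (blockAvg ℰ : Averaging P i G)) j U) p * (transfUp v j p.src)⁻¹ := by
  classical
  have hj0 : j ≤ P.m + P.K := (Nat.le_succ j).trans hj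
  set v : GaugeTransf P 0 G := axialT U (fun κ => ((((p.src κ).val * P.L ^ j : ℕ)) : ZMod (P.sitesPerDir 0))) with hv
  set Ut : GaugeField P 0 G := fun b => if b.src ∈ plaqCover p ∧ b.tgt ∈ plaqCover p then GaugeField.gaugeAct v U b else 1 with hUt
  have hon : ∀ b : PBond P 0, b.src ∈ plaqCover p → b.tgt ∈ plaqCover p → Ut b = GaugeField.gaugeAct v U b := fun b h1 h2 => by
    simp only [hUt, if_pos (And.intro h1 h2)]
  have hoff : ∀ b : PBond P 0, ¬ (b.src ∈ plaqCover p ∧ b.tgt ∈ plaqCover p) → Ut b = 1 := fun b h => by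
    simp only [hUt, if_neg h]
  have hsmall : ∀ b : PBond P 0, dist1 (Ut b) ≤ ((P.d : ℝ) + 2) * (P.L : ℝ) ^ j * a := by
    intro b
    by_cases h : b.src ∈ plaqCover p ∧ b.tgt ∈ plaqCover p
    · rw [hon b h.1 h.2]
      exact dist1_gaugeAct_axialT_le_of_cover hj p U ha hU b h.1 h.2
    · rw [hoff b h, GaugeGroup.dist1_one]
      positivity
  have hplaq : ∀ q ∈ plaqsIn 0 (plaqCover p), GaugeField.plaqHol Ut q = v q.src * GaugeField.plaqHol U q * (v q.src)⁻¹ := by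
    intro q hq
    rw [mem_plaqsIn_iff] at hq
    have h1 : q.src ∈ plaqCover p := hq (by simp [cornerSet])
    have h2 : q.src.shift q.μ ∈ plaqCover p := hq (by simp [cornerSet])
    have h3 : q.src.shift q.ν ∈ plaqCover p := hq (by simp [cornerSet])
    have h4 : (q.src.shift q.μ).shift q.ν ∈ plaqCover p := hq (by simp [cornerSet])
    have h4' : (q.src.shift q.ν).shift q.μ ∈ plaqCover p := by rw [← Site.shift_comm]; exact h4
    rw [← T4ReTrLipUnitary.plaqHol_gaugeAct v U q]
    unfold GaugeField.plaqHol
    rw [hon ⟨q.src, q.μ⟩ h1 h2, hon ⟨q.src.shift q.μ, q.ν⟩ h2 h4, hon ⟨q.src.shift q.ν, q.μ⟩ h3 h4', hon ⟨q.src, q.ν⟩ h1 h3]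
  have hiter : ∀ c : PBond P j, toFine j c.src ∈ plaqCover p → toFine j c.tgt ∈ plaqCover p →
      Averaging.iter (fun i => (blockAvg ℰ : Averaging P i G)) j Ut c =
        GaugeField.gaugeAct (transfUp v j) (Averaging.iter (fun i => (blockAvg ℰ : Averaging P i G)) j U) c := by
    intro c h1 h2
    rw [← T4Continuum.iter_gaugeAct (fun i => (blockAvg ℰ : Averaging P i G)) v j hj0 U]
    exact iter_eq_of_eqOn_cover ℰ hj0 p (fun b hb1 hb2 => hon b hb1 hb2) le_rfl h1 h2
  refine ⟨v, Ut, hon, hoff, hsmall, hplaq, hiter, ?_⟩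
  rw [← T4ReTrLipUnitary.plaqHol_gaugeAct (transfUp v j) _ p, ← T4Continuum.iter_gaugeAct (fun i => (blockAvg ℰ : Averaging P i G)) v j hj0 U]
  exact plaqHol_iter_eq_of_eqOn_cover ℰ hj0 p (fun b hb1 hb2 => hon b hb1 hb2)

/-! ## §5 `SU(N)`: the clamp meets [Balaban1985Averaging] Prop. 4 with the `k`-uniform constant -/

/-- **★★★ THE GAUGE CLAMP WITH ITS `k`-UNIFORM SECOND-ORDER EXPANSION** (`SU(N)`, the exp-mean-log (0.4)-averaging of record `expMeanLogSU`; `d + 2 ≤ L`, `j < m + K`).  Let the fine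
plaquettes with all corners in `Δ′(p′)` satisfy `‖U(∂q) − 1‖ ≤ a` and put `δ := (d+2)·L^j·a`, `m_s := 2|n|²(d+1)·L^s·δ`; assume the ONE window `324·L·(d+2)²·m_j ≤ 1`,
`4(d+2)L·m_j < δ_N`.  Then there are `v`, `Ũ` as in `exists_clamp` (for `expMeanLogSU`) with, in addition: `‖Ũ_b − 1‖ ≤ δ` everywhere; `‖Ũ(∂q) − 1‖ = ‖U(∂q) − 1‖` on the fine
plaquettes of `Δ′(p′)`; `‖Ū^{(j)}(∂p′) − 1‖ = ‖Ū̃^{(j)}(∂p′) − 1‖` (the symmetric largeness `v_sym` of `U` is that of `Ũ`); and for every `s ≤ j` and every level-`s` bond `c`: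
`‖Ū̃^{(s)}(c) − 1‖ ≤ 2m_s` and `‖Ū̃^{(s)}(c) − 1 − (Q^{(s)}Ỹ)(c)‖ ≤ 324·L·(d+2)²·m_s²`, `Ỹ = Ũ − 1`, for ANY linearised-average family `Q` (`Q 0 = id`, `Q (s+1) Y c =
linAvg (Q s Y) c`) — `EMLIterUniform.norm_iter_sub_one_sub_iterLin_le_uniform` applied to the globally `δ`-small `Ũ`.  With `a = α₀·L^{−2j}`: `m_j = 2|n|²(d+1)(d+2)·α₀`, `j`-FREE —
the (ii)-input of (69)_sym. [cite: Balaban1985Averaging, Prop. 4 (134)–(135) p.38, Prop. 2 (52)–(54) p.26, (8)-(11) p.19; Balaban1985UV3, (68)–(70) p.273] -/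
theorem exists_clamp_expansion {n : Type*} [Fintype n] [DecidableEq n] [Nonempty n]
    (Q : (i : ℕ) → (PBond P 0 → Matrix n n ℂ) → PBond P i → Matrix n n ℂ)
    (hQ0 : ∀ Y, Q 0 Y = Y) (hQs : ∀ (i : ℕ) (Y : PBond P 0 → Matrix n n ℂ) (c : PBond P (i + 1)), Q (i + 1) Y c = linAvg (Q i Y) c)
    (hL : P.d + 2 ≤ P.L) (hj : j + 1 ≤ P.m + P.K) (p : Plaq P j) (U : GaugeField P 0 (Matrix.specialUnitaryGroup n ℂ))
    {a : ℝ} (ha : 0 ≤ a)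
    (hU : ∀ q ∈ plaqsIn 0 (plaqCover p), ‖((GaugeField.plaqHol U q : Matrix.specialUnitaryGroup n ℂ) : Matrix n n ℂ) - 1‖ ≤ a)
    (hm : 324 * (P.L : ℝ) * ((P.d : ℝ) + 2) ^ 2 *
      (2 * (Fintype.card n : ℝ) ^ 2 * (((P.d : ℝ) + 1) * (P.L : ℝ) ^ j * (((P.d : ℝ) + 2) * (P.L : ℝ) ^ j * a))) ≤ 1)
    (hN : 4 * (((P.d + 2) * P.L : ℕ) : ℝ) *
      (2 * (Fintype.card n : ℝ) ^ 2 * (((P.d : ℝ) + 1) * (P.L : ℝ) ^ j * (((P.d : ℝ) + 2) * (P.L : ℝ) ^ j * a))) < deltaSU n) :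
    ∃ (v : GaugeTransf P 0 (Matrix.specialUnitaryGroup n ℂ)) (Ut : GaugeField P 0 (Matrix.specialUnitaryGroup n ℂ)),
      (∀ b : PBond P 0, b.src ∈ plaqCover p → b.tgt ∈ plaqCover p → Ut b = GaugeField.gaugeAct v U b) ∧
      (∀ b : PBond P 0, ¬ (b.src ∈ plaqCover p ∧ b.tgt ∈ plaqCover p) → Ut b = 1) ∧
      (∀ b : PBond P 0, ‖((Ut b : Matrix.specialUnitaryGroup n ℂ) : Matrix n n ℂ) - 1‖ ≤ ((P.d : ℝ) + 2) * (P.L : ℝ) ^ j * a) ∧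
      (∀ q ∈ plaqsIn 0 (plaqCover p), GaugeField.plaqHol Ut q = v q.src * GaugeField.plaqHol U q * (v q.src)⁻¹) ∧
      (∀ q ∈ plaqsIn 0 (plaqCover p),
        ‖((GaugeField.plaqHol Ut q : Matrix.specialUnitaryGroup n ℂ) : Matrix n n ℂ) - 1‖ =
          ‖((GaugeField.plaqHol U q : Matrix.specialUnitaryGroup n ℂ) : Matrix n n ℂ) - 1‖) ∧
      (∀ c : PBond P j, toFine j c.src ∈ plaqCover p → toFine j c.tgt ∈ plaqCover p →
        Averaging.iter (fun i => (blockAvg (expMeanLogSU (n := n)) : Averaging P i (Matrix.specialUnitaryGroup n ℂ))) j Ut c =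
          GaugeField.gaugeAct (transfUp v j)
            (Averaging.iter (fun i => (blockAvg (expMeanLogSU (n := n)) : Averaging P i (Matrix.specialUnitaryGroup n ℂ))) j U) c) ∧
      GaugeField.plaqHol (Averaging.iter (fun i => (blockAvg (expMeanLogSU (n := n)) : Averaging P i (Matrix.specialUnitaryGroup n ℂ))) j Ut) p =
        transfUp v j p.src *
          GaugeField.plaqHol (Averaging.iter (fun i => (blockAvg (expMeanLogSU (n := n)) : Averaging P i (Matrix.specialUnitaryGroup n ℂ))) j U) p *
          (transfUp v j p.src)⁻¹ ∧
      ‖((GaugeField.plaqHol (Averaging.iter (fun i => (blockAvg (expMeanLogSU (n := n)) : Averaging P i (Matrix.specialUnitaryGroup n ℂ))) j U) p :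
          Matrix.specialUnitaryGroup n ℂ) : Matrix n n ℂ) - 1‖ =
        ‖((GaugeField.plaqHol (Averaging.iter (fun i => (blockAvg (expMeanLogSU (n := n)) : Averaging P i (Matrix.specialUnitaryGroup n ℂ))) j Ut) p :
          Matrix.specialUnitaryGroup n ℂ) : Matrix n n ℂ) - 1‖ ∧
      (∀ s : ℕ, s ≤ j → ∀ c : PBond P s,
        ‖((Averaging.iter (fun i => blockAvg (P := P) (j := i) (expMeanLogSU (n := n))) s Ut c : Matrix.specialUnitaryGroup n ℂ) : Matrix n n ℂ) - 1‖ ≤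
            2 * (2 * (Fintype.card n : ℝ) ^ 2 * (((P.d : ℝ) + 1) * (P.L : ℝ) ^ s * (((P.d : ℝ) + 2) * (P.L : ℝ) ^ j * a))) ∧
        ‖((Averaging.iter (fun i => blockAvg (P := P) (j := i) (expMeanLogSU (n := n))) s Ut c : Matrix.specialUnitaryGroup n ℂ) : Matrix n n ℂ) - 1 -
            Q s (fun b => ((Ut b : Matrix.specialUnitaryGroup n ℂ) : Matrix n n ℂ) - 1) c‖ ≤
          324 * (P.L : ℝ) * ((P.d : ℝ) + 2) ^ 2 * (2 * (Fintype.card n : ℝ) ^ 2 * (((P.d : ℝ) + 1) * (P.L : ℝ) ^ s * (((P.d : ℝ) + 2) * (P.L : ℝ) ^ j * a))) ^ 2) := by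
  have hdist : ∀ g : Matrix.specialUnitaryGroup n ℂ, dist1 g = ‖(g : Matrix n n ℂ) - 1‖ := fun g => rfl
  have hU' : ∀ q ∈ plaqsIn 0 (plaqCover p), dist1 (GaugeField.plaqHol U q) ≤ a := fun q hq => by rw [hdist]; exact hU q hq
  obtain ⟨v, Ut, hon, hoff, hsmall, hplaq, hiter, hp⟩ := exists_clamp (expMeanLogSU (n := n)) hj p U ha hU'
  have hδ : 0 ≤ ((P.d : ℝ) + 2) * (P.L : ℝ) ^ j * a := by positivity
  have hsmall' : ∀ b : PBond P 0, ‖((Ut b : Matrix.specialUnitaryGroup n ℂ) : Matrix n n ℂ) - 1‖ ≤ ((P.d : ℝ) + 2) * (P.L : ℝ) ^ j * a :=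
    fun b => by rw [← hdist]; exact hsmall b
  have hexp := norm_iter_sub_one_sub_iterLin_le_uniform Q hQ0 hQs hL Ut hδ hsmall' j hm hN
  refine ⟨v, Ut, hon, hoff, hsmall', hplaq, fun q hq => ?_, hiter, hp, ?_, hexp⟩
  · rw [← hdist, ← hdist, hplaq q hq, GaugeGroup.dist1_conj]
  · rw [← hdist, ← hdist, hp, GaugeGroup.dist1_conj]

end Summit.QuantumFields.YangMills.Theorems.SymAvgGaugeClamp

end
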